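import Literature.NumberTheory.LFunctions.BettinConreyFarmer2013ZeroSums
import Literature.NumberTheory.LFunctions.ZetaZeroWindowsExplicit
import HarnessLib

/-!
# RH-FREE — The Cauchy-kernel zero sum, explicit: `∑_ρ 1/(1 + (t − γ)²) ≤ 144 log(|t| + 2)` over any finite set of distinct non-trivial zeros («nothing here bears on the truth of RH»)

Topic `Literature/NumberTheory/LFunctions` (RH literature cell, L4 "explicit zero statistics").
Label: **RH-FREE** — THEOREMS only, no named fact, no definition; nothing here bears on the truth
of RH.

The classical lemma `∑_ρ 1/(1 + (t − γ)²) = O(log t)` (Titchmarsh §9.2, from Theorem 9.2; Davenport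
Ch. 15) is proved in the tree with an inexplicit constant `K = 48 C₀`
(`Literature.NumberTheory.LFunctions.BCF.exists_sum_kernel_le`, `C₀` the window constant of
`Literature.NumberTheory.LFunctions.exists_zetaZeroCount_window_le`), through the parametric
`Literature.NumberTheory.LFunctions.BCF.sum_kernel_pos_le` (`≤ 24 C₀ log(|t|+2)` under the window
hypothesis `hW`).  Feeding it the explicit window bound `C₀ = 3`
(`Literature.NumberTheory.LFunctions.zetaZeroCount_window_le_three_log`, `ZetaZeroWindowsExplicit.lean`)
gives explicit constants:

* `Literature.NumberTheory.LFunctions.sum_kernel_pos_le_explicit` — over distinct non-trivial zeros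
  with positive ordinate, `∑_{ρ ∈ F} 1/(1 + (t − Im ρ)²) ≤ 72 log(|t| + 2)` for every real `t`;
* `Literature.NumberTheory.LFunctions.sum_kernel_le_explicit` — over any finite set of distinct
  non-trivial zeros (both signs), **`∑_{ρ ∈ F} 1/(1 + (t − Im ρ)²) ≤ 144 log(|t| + 2)`**.

(The constants are those of the tree's window-to-kernel bookkeeping, `24 C₀` per sign; no attempt at
the sharp `≈ ½ log t`.)

## References

* E. C. Titchmarsh, *The Theory of the Riemann Zeta-Function*, 2nd ed., §9.2 (Thm. 9.2 and its
  consequences). [Titchmarsh1986]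
-/

noncomputable section

open Complex Real
open scoped ComplexConjugate

namespace Literature.NumberTheory.LFunctions

/-- **Explicit Cauchy-kernel sum, positive ordinates**: for every real `t` and every finite set `F`
of distinct non-trivial zeros of `ζ` with positive imaginary part,
`∑_{ρ ∈ F} 1/(1 + (t − Im ρ)²) ≤ 72 log(|t| + 2)`. [cite: Titchmarsh1986, §9.2 Thm. 9.2] -/
theorem sum_kernel_pos_le_explicit (t : ℝ) (F : Finset ℂ)
    (hF : ∀ ρ ∈ F, ρ ∈ ZetaZeros.riemannZetaNontrivialZeros ∧ 0 < ρ.im) :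
    ∑ ρ ∈ F, 1 / (1 + (t - ρ.im) ^ 2) ≤ 72 * Real.log (|t| + 2) := by
  have h := BCF.sum_kernel_pos_le (C₀ := 3) (by norm_num) zetaZeroCount_window_le_three_log t F hF
  linarith

/-- **Explicit Cauchy-kernel sum over distinct non-trivial zeros (both signs of the ordinate)**:
`∑_{ρ ∈ F} 1/(1 + (t − Im ρ)²) ≤ 144 log(|t| + 2)` for every real `t` (the negative ordinates by
conjugation, as in `Literature.NumberTheory.LFunctions.BCF.exists_sum_kernel_le`).
[cite: Titchmarsh1986, §9.2 Thm. 9.2] -/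
theorem sum_kernel_le_explicit (t : ℝ) (F : Finset ℂ)
    (hF : ∀ ρ ∈ F, ρ ∈ ZetaZeros.riemannZetaNontrivialZeros) :
    ∑ ρ ∈ F, 1 / (1 + (t - ρ.im) ^ 2) ≤ 144 * Real.log (|t| + 2) := by
  classical
  have hW := zetaZeroCount_window_le_three_log
  rw [← Finset.sum_filter_add_sum_filter_not F (fun ρ : ℂ ↦ 0 < ρ.im)]
  set F₁ := F.filter (fun ρ : ℂ ↦ 0 < ρ.im) with hF₁
  set F₂ := F.filter (fun ρ : ℂ ↦ ¬ 0 < ρ.im) with hF₂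
  have h1 : ∑ ρ ∈ F₁, 1 / (1 + (t - ρ.im) ^ 2) ≤ 24 * 3 * Real.log (|t| + 2) :=
    BCF.sum_kernel_pos_le (by norm_num) hW t F₁ fun ρ hρ ↦ by
      rw [hF₁, Finset.mem_filter] at hρ; exact ⟨hF ρ hρ.1, hρ.2⟩
  have h2 : ∑ ρ ∈ F₂, 1 / (1 + (t - ρ.im) ^ 2) ≤ 24 * 3 * Real.log (|t| + 2) := by
    have hinj : Set.InjOn (fun ρ : ℂ ↦ conj ρ) F₂ := fun a _ b _ h ↦ by
      simpa using congrArg conj h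
    have e1 : ∑ ρ ∈ F₂, 1 / (1 + (t - ρ.im) ^ 2) =
        ∑ ρ ∈ F₂, 1 / (1 + ((-t) - (conj ρ).im) ^ 2) :=
      Finset.sum_congr rfl fun ρ _ ↦ by rw [Complex.conj_im]; ring
    have e2 : ∑ ρ ∈ F₂, 1 / (1 + ((-t) - (conj ρ).im) ^ 2) =
        ∑ z ∈ F₂.image (fun ρ : ℂ ↦ conj ρ), 1 / (1 + ((-t) - z.im) ^ 2) :=
      (Finset.sum_image (f := fun z : ℂ ↦ 1 / (1 + ((-t) - z.im) ^ 2))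
        fun a ha b hb h ↦ hinj ha hb h).symm
    rw [e1, e2]
    have h := BCF.sum_kernel_pos_le (C₀ := 3) (by norm_num) hW (-t) (F₂.image fun ρ : ℂ ↦ conj ρ)
      fun z hz ↦ by
        rw [Finset.mem_image] at hz
        obtain ⟨ρ, hρ, rfl⟩ := hz
        rw [hF₂, Finset.mem_filter] at hρ
        have hmem := hF ρ hρ.1
        have hneg : ρ.im < 0 :=
          lt_of_le_of_ne (not_lt.1 hρ.2) (ZetaZeros.riemannZetaNontrivialZeros.im_ne_zero hmem)
        exact ⟨ZetaZeros.riemannZetaNontrivialZeros.conj_mem hmem, by simpa using hneg⟩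
    rwa [abs_neg] at h
  linarith

end Literature.NumberTheory.LFunctions

end
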